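import Literature.NumberTheory.IwasawaTheory.WeakLeopoldtCyclotomicProof
import Literature.NumberTheory.IwasawaTheory.Greenberg2006.TwistDeformationLEO
import Literature.NumberTheory.GaloisRepresentations.ProfiniteIntersectionTorsionCoefficients
import Literature.NumberTheory.EllipticCurves.IwasawaCyclotomicProofs
import Literature.NumberTheory.IwasawaTheory.PruferPontryaginDual
import HarnessLib

/-!
# Weak Leopoldt above a `ℤ_p^m`-extension containing the cyclotomic one — Greenberg's (T4)
# `weakLeopoldt_H2_subsingleton_above_cyclotomic_of_isOpen` — is a THEOREM of the Literature tree

Topic `NumberTheory/IwasawaTheory/Greenberg2006`; namespace `Literature.NumberTheory.IwasawaTheory.Greenberg2006`.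
Theorems only (no definition, no named fact, no instance; D-0026).  Width seat `bsd-line-x1-p1-w2`
gen 8 of cell `bsd-eis`, D-0154 (2) INPUTS lane.

The named fact (T4) of `GaloisCohomologyStructure.lean` §5 ([Gr4] = Greenberg 2006, pp. 343–344;
[NQD84] = Nguyen Quang Do 1984, Thm. 2.2; open-subgroup presentation): for a number field `K`, an odd
prime `p`, a finite `S ⊇ {v ∣ p}`, `ℤ_p`-extensions `κ₁, …, κ_m`, an open `U₀ ≥ N_S` (`K′ := K̄^{U₀}`)
with `K′K̃_∞ ⊇ K′^{cyc}` ("`χ_p` torsion on `U₀ ∩ ⋂ᵢ ker κᵢ`"), `H²(K_Σ/K′K̃_∞, D) = 0` for every discrete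
`D ≃ ℚ_p/ℤ_p` with the trivial action.  It FOLLOWS from its cyclotomic case `m = 1`, `κ₁ = κ^{cyc}` —
Iwasawa's theorem, the named fact `weakLeopoldt_H2_subsingleton_cyclotomic_of_isOpen`, now PROVED in
the Literature tree (`WeakLeopoldtCyclotomicProof.weakLeopoldt_H2_subsingleton_cyclotomic_of_isOpen_holds`)
— by [NQD84]'s reduction: `Gal(K_Σ/K′K̃_∞) = ⋂ⱼ Gal(K_Σ/K′_j K^{cyc}_∞)` over the layers
`K′_j = K̄^{U₀ ∩ V_j}`, `V_j = ⋂ᵢ κᵢ⁻¹(p^j ℤ_p)`, of `K′K̃_∞/K′`, each `H²(K_Σ/K′_j K^{cyc}_∞, D)`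
vanishing by the cyclotomic case at the open subgroup `U₀ ∩ V_j ≥ N_S`, and `H²` of a decreasing
intersection of closed subgroups of the profinite `G_{K,S}` with discrete torsion coefficients
vanishing when it does at every stage (`GaloisRepresentations.subsingleton_H2_trivial_iInf_of_forall`,
Serre I §2.2 Prop. 8).

* §1 plumbing (the Literature-side copies of the Summits-side lemmas of
  `Summits/…/EisensteinPrimesGoodLatticeBDPValueT4OfCyclotomic.lean`, seat `-w2` gen 7, which
  Literature files cannot import): `⋂ᵢ ker (![κ])ᵢ = ker κ`; the `χ_p`-torsion clause ⟺
  `U₀ ∩ ⋂ᵢ ker κᵢ ≤ ker κ^{cyc}`; the open multi-layer subgroups `V_j` with `⋂ⱼ V_j = ⋂ᵢ ker κᵢ`;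
  `U₀ ∩ ⋂ᵢ ker κᵢ = ⋂ⱼ (U₀ ∩ V_j ∩ ker κ^{cyc})`; `galoisGroupAbove S` commutes with intersections of
  subgroups containing `N_S`.
* §2 `above_cyclotomic_of_cyclotomic` — cycWL ⟹ (T4);
  **`weakLeopoldt_H2_subsingleton_above_cyclotomic_of_isOpen_holds`** — (T4) DISCHARGED at its
  Literature home (the binder `hT4` of `TwistDeformationLEO.lean` §6); and
  **`weakLeopoldt_H2_subsingleton_above_cyclotomic_holds`** — Greenberg's (A) =
  `GaloisCohomologyStructure.lean` §1 (E) ([Gr4] pp. 343–344, Hypothesis L), its case `U₀ = ⊤`.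

HONEST FRAMING: published theorems (Iwasawa 1973 / NSW (10.3.25); [NQD84] Thm. 2.2; [Gr4] p. 344),
now kernel facts of the Literature tree; no conjecture is touched; the Summits-side twins
(`…T4OfCyclotomic` p665558, `…StagesDie` p672832) are untouched.

References: [Greenberg2006] pp. 341–344; [NguyenQuangDo1984] Déf. 2.1, Thm. 2.2; [Iwasawa1973] §2;
[NeukirchSchmidtWingberg2008] (10.3.22), (10.3.25); [Washington1997] §13.1; [SerreGaloisCohomology1997]
I §2.2 Prop. 8.
-/

noncomputable section

open scoped Classical
open NumberField IsDedekindDomain Field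
open Literature.NumberTheory.GaloisRepresentations
open Literature.NumberTheory.EllipticCurves (ZpExtension)
open Literature.NumberTheory.IwasawaTheory

namespace Literature.NumberTheory.IwasawaTheory.Greenberg2006

/-- Transport of the vanishing `H²(H, D) = 0` (trivial coefficients) along an EQUALITY of subgroups
`H₁ = H₂` of a topological group. [folklore] -/
private theorem subsingleton_H2_trivial_subgroup_congr' {G : Type} [Group G] [TopologicalSpace G]
    [IsTopologicalGroup G] {R : Type} [CommRing R] [TopologicalSpace R] [IsTopologicalRing R]
    {D : Type} [AddCommGroup D] [Module R D] [TopologicalSpace D] [DiscreteTopology D]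
    [ContinuousSMul R D] {H₁ H₂ : Subgroup G} (e : H₁ = H₂)
    (h : Subsingleton ((ContinuousRep.trivial H₁ R D).H 2)) :
    Subsingleton ((ContinuousRep.trivial H₂ R D).H 2) := by
  subst e
  exact h

/-! ### §1. Plumbing: `⋂ᵢ ker κᵢ` for `m = 1`; the `χ_p`-torsion clause; the layers -/

section Plumbing

variable {K : Type} [Field K] {p : ℕ} [Fact p.Prime]

/-- For a single `ℤ_p`-extension, `⋂ᵢ ker (![κ])ᵢ = ker κ`. [cite: Greenberg2006, p. 341 L39–45] -/
theorem multiZpKer_singleton (κ : ZpExtension K p) : multiZpKer p ![κ] = κ.kerSubgroup := by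
  ext σ
  simp [mem_multiZpKer_iff, ZpExtension.mem_kerSubgroup]

/-- **The `χ_p`-torsion clause of (T4) says `U₀ ∩ ⋂ᵢ ker κᵢ ≤ ker κ^{cyc}`** for the cyclotomic
`ℤ_p`-extension `κ^{cyc}` (`IsCyclotomic`: `ker κ^{cyc} = χ_p⁻¹(μ(ℤ_p))`).
[cite: Greenberg2006, pp. 343–344] [cite: Washington1997, §13.1] -/
theorem inf_multiZpKer_le_kerSubgroup_of_isCyclotomic {m : ℕ} (κ : Fin m → ZpExtension K p)
    (U₀ : Subgroup (absoluteGaloisGroup K)) {κ₀ : ZpExtension K p} (hκ₀ : κ₀.IsCyclotomic)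
    (hcyc : ∀ σ : absoluteGaloisGroup K, σ ∈ U₀ ⊓ multiZpKer p κ →
      GaloisRep.cyclotomicCharacter K p σ ∈ CommGroup.torsion ℤ_[p]ˣ) :
    U₀ ⊓ multiZpKer p κ ≤ κ₀.kerSubgroup := by
  intro σ hσ
  have h : κ₀.kerSubgroup = (CommGroup.torsion ℤ_[p]ˣ).comap
      (GaloisRep.cyclotomicCharacter K p).toMonoidHom := hκ₀
  rw [h, Subgroup.mem_comap]
  exact hcyc σ hσ

/-- An element of `ℤ_p` divisible by every power of `p` is `0`. [folklore] -/
private theorem padicInt_eq_zero_of_forall_pow_dvd' {x : ℤ_[p]} (hx : ∀ n : ℕ, (p : ℤ_[p]) ^ n ∣ x) :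
    x = 0 := by
  by_contra h0
  have hpos : 0 < ‖x‖ := norm_pos_iff.mpr h0
  have hle : ∀ n : ℕ, ‖x‖ ≤ (p : ℝ) ^ (-(n : ℤ)) := fun n ↦ by
    rw [PadicInt.norm_le_pow_iff_mem_span_pow]
    exact Ideal.mem_span_singleton.mpr (hx n)
  have hp1 : (1 : ℝ) < p := by exact_mod_cast (Fact.out : p.Prime).one_lt
  obtain ⟨n, hn⟩ := exists_pow_lt_of_lt_one hpos (inv_lt_one_of_one_lt₀ hp1)
  have h' : (p : ℝ) ^ (-(n : ℤ)) = ((p : ℝ)⁻¹) ^ n := by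
    rw [zpow_neg, zpow_natCast, inv_pow]
  exact absurd (hle n) (by rw [h']; exact not_le.mpr hn)

/-- The **multi-layer subgroup** `V_j = ⋂ᵢ κᵢ⁻¹(p^j ℤ_p) ≤ Γ_K` (`Gal(K̄/K̃_j)`, `K̃_j` the compositum of
the `j`-th layers) is open. [cite: Greenberg2006, p. 341 L39–45] [cite: Washington1997, §13.1] -/
theorem isOpen_multiLayer {m : ℕ} (κ : Fin m → ZpExtension K p) (j : ℕ) :
    IsOpen ((⨅ i, (κ i).layerSubgroup j : Subgroup (absoluteGaloisGroup K)) :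
      Set (absoluteGaloisGroup K)) := by
  rw [Subgroup.coe_iInf]
  exact isOpen_iInter_of_finite fun i ↦ (κ i).isOpen_layerSubgroup j

/-- `V_j` decreases with `j`. [cite: Washington1997, §13.1] -/
theorem multiLayer_antitone {m : ℕ} (κ : Fin m → ZpExtension K p) :
    Antitone fun j ↦ (⨅ i, (κ i).layerSubgroup j : Subgroup (absoluteGaloisGroup K)) :=
  fun _ _ hjk ↦ iInf_mono fun i ↦ (κ i).layerSubgroup_antitone hjk

/-- `⋂ᵢ ker κᵢ ≤ V_j`. [cite: Washington1997, §13.1] -/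
theorem multiZpKer_le_multiLayer {m : ℕ} (κ : Fin m → ZpExtension K p) (j : ℕ) :
    multiZpKer p κ ≤ ⨅ i, (κ i).layerSubgroup j :=
  iInf_mono fun i ↦ (κ i).kerSubgroup_le_layerSubgroup j

/-- `⋂ⱼ V_j = ⋂ᵢ ker κᵢ` (`⋂ⱼ p^j ℤ_p = 0`). [cite: Washington1997, §13.1] -/
theorem iInf_multiLayer {m : ℕ} (κ : Fin m → ZpExtension K p) :
    ⨅ j, (⨅ i, (κ i).layerSubgroup j : Subgroup (absoluteGaloisGroup K)) = multiZpKer p κ := by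
  refine le_antisymm (fun σ hσ ↦ ?_) (le_iInf fun j ↦ multiZpKer_le_multiLayer κ j)
  rw [Subgroup.mem_iInf] at hσ
  rw [mem_multiZpKer_iff]
  intro i
  have hdvd : ∀ j : ℕ, (p : ℤ_[p]) ^ j ∣ (κ i σ).toAdd := fun j ↦
    ZpExtension.mem_layerSubgroup.mp (Subgroup.mem_iInf.mp (hσ j) i)
  have h0 := padicInt_eq_zero_of_forall_pow_dvd' hdvd
  rw [← toAdd_one] at h0
  exact Multiplicative.toAdd.injective h0

/-- **`U₀ ∩ ⋂ᵢ ker κᵢ = ⋂ⱼ (U₀ ∩ V_j ∩ ker κ^{cyc})`** once `U₀ ∩ ⋂ᵢ ker κᵢ ≤ ker κ^{cyc}`.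
[cite: NguyenQuangDo1984, Thm. 2.2 (proof)] -/
theorem inf_multiZpKer_eq_iInf {m : ℕ} (κ : Fin m → ZpExtension K p)
    (U₀ : Subgroup (absoluteGaloisGroup K)) (κ₀ : ZpExtension K p)
    (hle : U₀ ⊓ multiZpKer p κ ≤ κ₀.kerSubgroup) :
    U₀ ⊓ multiZpKer p κ = ⨅ j, ((U₀ ⊓ ⨅ i, (κ i).layerSubgroup j) ⊓ κ₀.kerSubgroup) := by
  refine le_antisymm (le_iInf fun j ↦ le_inf (inf_le_inf_left U₀ (multiZpKer_le_multiLayer κ j)) hle)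
    (fun σ hσ ↦ ?_)
  rw [Subgroup.mem_iInf] at hσ
  have h2 : σ ∈ multiZpKer p κ := by
    rw [← iInf_multiLayer κ, Subgroup.mem_iInf]
    exact fun j ↦ (Subgroup.mem_inf.mp (Subgroup.mem_inf.mp (hσ j)).1).2
  exact Subgroup.mem_inf.mpr ⟨(Subgroup.mem_inf.mp (Subgroup.mem_inf.mp (hσ 0)).1).1, h2⟩

end Plumbing

/-! ### §1b. `galoisGroupAbove S` commutes with intersections of subgroups containing `N_S` -/

section Above

variable {K : Type} [Field K] (S : Set (HeightOneSpectrum (𝓞 K)))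

/-- **`Gal(K_Σ/⋃ⱼ K_j) = ⋂ⱼ Gal(K_Σ/K_j)` inside `G_{K,S}`**: the image in `Γ_K/N_S` of an intersection
of subgroups CONTAINING `N_S` is the intersection of the images. [cite: Greenberg2006, p. 342 (display (2))] -/
theorem galoisGroupAbove_iInf {ι : Sort*} [Nonempty ι] (W : ι → Subgroup (absoluteGaloisGroup K))
    (hW : ∀ i, ramificationSubgroup K S ≤ W i) :
    galoisGroupAbove S (⨅ i, W i) = ⨅ i, galoisGroupAbove S (W i) := by
  refine le_antisymm (le_iInf fun i ↦ Subgroup.map_mono (iInf_le W i)) fun g hg ↦ ?_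
  rw [Subgroup.mem_iInf] at hg
  obtain ⟨σ, rfl⟩ := toUnramifiedQuot_surjective K S g
  refine (mem_galoisGroupAbove_iff S _ _).mpr ⟨σ, ?_, rfl⟩
  rw [Subgroup.mem_iInf]
  intro i
  obtain ⟨τ, hτ, hτσ⟩ := (mem_galoisGroupAbove_iff S _ _).mp (hg i)
  have h1 : toUnramifiedQuot K S (τ⁻¹ * σ) = 1 := by
    rw [map_mul, map_inv, hτσ, inv_mul_cancel]
  have hmem : τ⁻¹ * σ ∈ ramificationSubgroup K S := (QuotientGroup.eq_one_iff _).mp h1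
  simpa using (W i).mul_mem hτ (hW i hmem)

end Above

/-! ### §2. cycWL ⟹ (T4), and (T4) holds -/

section Reduction

/-- **Every element of a group additively isomorphic to `ℚ_p/ℤ_p` has finite order.** [folklore] -/
private theorem isTorsion_of_addEquiv_quotientSubring' {p : ℕ} [Fact p.Prime] {D : Type}
    [AddCommGroup D] (e : D ≃+ ℚ_[p] ⧸ (PadicInt.subring p).toAddSubgroup) :
    AddMonoid.IsTorsion D := by
  intro d
  set x : QpModZp p := (QpModZp.addEquivQuotientSubring p).symm (e d) with hx
  obtain ⟨k, hk⟩ := QpModZp.exists_pow_nsmul_eq_zero (p := p) x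
  refine isOfFinAddOrder_iff_nsmul_eq_zero.mpr ⟨p ^ k, pow_pos (Fact.out : p.Prime).pos k, ?_⟩
  apply e.injective
  apply (QpModZp.addEquivQuotientSubring p).symm.injective
  rw [map_nsmul, map_nsmul, ← hx, hk, map_zero, map_zero]

/-- **cycWL ⟹ (T4): weak Leopoldt above a `ℤ_p^m`-extension containing the cyclotomic one FOLLOWS
from the cyclotomic case** ([NQD84]'s reduction: `Gal(K_Σ/K′K̃_∞) = ⋂ⱼ Gal(K_Σ/K′_j K^{cyc}_∞)` over
the layers `K′_j` of `K′K̃_∞/K′`, and `H²` of a decreasing intersection of closed subgroups of the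
profinite `G_{K,S}` with discrete torsion coefficients vanishes when it vanishes at every stage,
Serre I §2.2 Prop. 8).  Literature-side twin of the Summits-side `…T4OfCyclotomic.above_cyclotomic_of_cyclotomic`.
[cite: NguyenQuangDo1984, Thm. 2.2] [cite: Greenberg2006, pp. 343–344]
[cite: NeukirchSchmidtWingberg2008, (10.3.25)] [cite: SerreGaloisCohomology1997, I §2.2 Prop. 8] -/
theorem above_cyclotomic_of_cyclotomic
    (h : weakLeopoldt_H2_subsingleton_cyclotomic_of_isOpen) :
    weakLeopoldt_H2_subsingleton_above_cyclotomic_of_isOpen := by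
  intro K _ _ p _ hp S hSf hS m κ U₀ hU₀ hN hcyc R _ _ _ D _ _ _ _ _ hD
  -- the cyclotomic `ℤ_p`-extension of `K`
  obtain ⟨κ₀, hκ₀⟩ := Literature.NumberTheory.EllipticCurves.exists_cyclotomicZpExtension_holds K p
  have hle : U₀ ⊓ multiZpKer p κ ≤ κ₀.kerSubgroup :=
    inf_multiZpKer_le_kerSubgroup_of_isCyclotomic κ U₀ hκ₀ hcyc
  -- the stages `W_j = U₀ ∩ V_j ∩ ker κ₀` and their images in `G_{K,S}`
  set W : ℕ → Subgroup (absoluteGaloisGroup K) :=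
    fun j ↦ (U₀ ⊓ ⨅ i, (κ i).layerSubgroup j) ⊓ κ₀.kerSubgroup
    with hW
  have hNW : ∀ j, ramificationSubgroup K S ≤ W j := fun j ↦
    le_inf (le_inf hN ((ramificationSubgroup_le_multiZpKer S p κ hS).trans (multiZpKer_le_multiLayer κ j)))
      ((ramificationSubgroup_le_multiZpKer S p ![κ₀] hS).trans (multiZpKer_singleton κ₀).le)
  have hWanti : Antitone W := fun j k hjk ↦
    inf_le_inf_right _ (inf_le_inf_left _ (multiLayer_antitone κ hjk))
  have hWcl : ∀ j, IsClosed ((W j : Subgroup (absoluteGaloisGroup K)) : Set (absoluteGaloisGroup K)) :=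
    fun j ↦ ((Subgroup.isClosed_of_isOpen U₀ hU₀).inter
      (Subgroup.isClosed_of_isOpen _ (isOpen_multiLayer κ j))).inter κ₀.isClosed_kerSubgroup
  -- each stage: cycWL at the open subgroup `U₀ ∩ V_j ⊇ N_S`
  have hstage : ∀ j, Subsingleton ((ContinuousRep.trivial (galoisGroupAbove S (W j)) R D).H 2) :=
    fun j ↦ h K p hp S hSf hS κ₀ hκ₀ (U₀ ⊓ ⨅ i, (κ i).layerSubgroup j) (hU₀.inter (isOpen_multiLayer κ j))
      (le_inf hN ((ramificationSubgroup_le_multiZpKer S p κ hS).trans (multiZpKer_le_multiLayer κ j)))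
      R D hD
  -- the limit lemma in the profinite group `G_{K,S}`
  haveI : TotallyDisconnectedSpace (GaloisGroupUnramifiedOutside K S) :=
    totallyDisconnectedSpace_galoisGroupUnramifiedOutside S
  have hlim : Subsingleton
      ((ContinuousRep.trivial (⨅ j, galoisGroupAbove S (W j) :
        Subgroup (GaloisGroupUnramifiedOutside K S)) R D).H 2) :=
    subsingleton_H2_trivial_iInf_of_forall (isTorsion_of_addEquiv_quotientSubring' hD.some)
      (fun j ↦ galoisGroupAbove S (W j)) (fun j k hjk ↦ Subgroup.map_mono (hWanti hjk))
      (fun j ↦ isClosed_galoisGroupAbove S (W j) (hWcl j)) hstage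
  -- transport along `Gal(K_Σ/K′K̃_∞) = ⋂ⱼ Gal(K_Σ/K′_j K^{cyc}_∞)`
  have heq : (⨅ j, galoisGroupAbove S (W j)) = galoisGroupAbove S (U₀ ⊓ multiZpKer p κ) := by
    rw [inf_multiZpKer_eq_iInf κ U₀ κ₀ hle, galoisGroupAbove_iInf S W hNW]
  exact subsingleton_H2_trivial_subgroup_congr' heq hlim

/-- **Greenberg's (T4) HOLDS** — weak Leopoldt above every `ℤ_p^m`-extension `K′K̃_∞ ⊇ K′^{cyc}` of
a finite `K′ ⊆ K_Σ` over a number field `K` (`p` odd, `S ⊇ {v ∣ p}` finite, `D ≃ ℚ_p/ℤ_p` with the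
trivial action): the named fact `weakLeopoldt_H2_subsingleton_above_cyclotomic_of_isOpen` of
`GaloisCohomologyStructure.lean` §5 ([Gr4] pp. 343–344 = [NQD84] Thm. 2.2) DISCHARGED at its
Literature home, from Iwasawa's cyclotomic case (`weakLeopoldt_H2_subsingleton_cyclotomic_of_isOpen_holds`,
`WeakLeopoldtCyclotomicProof.lean`) by `above_cyclotomic_of_cyclotomic`.
[cite: Greenberg2006, pp. 343–344] [cite: NguyenQuangDo1984, Thm. 2.2]
[cite: NeukirchSchmidtWingberg2008, (10.3.25) with (10.3.22)] [cite: Iwasawa1973, §2] -/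
theorem weakLeopoldt_H2_subsingleton_above_cyclotomic_of_isOpen_holds :
    weakLeopoldt_H2_subsingleton_above_cyclotomic_of_isOpen :=
  above_cyclotomic_of_cyclotomic weakLeopoldt_H2_subsingleton_cyclotomic_of_isOpen_holds

/-- **Greenberg's weak Leopoldt theorem (A) HOLDS** — `H²(Gal(K_Σ/K̃_∞), D) = 0` for every
`ℤ_p^m`-extension `K̃_∞ ⊇ K^{cyc}_∞` of a number field `K` (`p` odd, `S ⊇ {v ∣ p}` finite,
`D ≃ ℚ_p/ℤ_p` with the trivial action): the named fact `weakLeopoldt_H2_subsingleton_above_cyclotomic`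
of `GaloisCohomologyStructure.lean` §1 (E) ([Gr4] pp. 343–344 with Hypothesis L p. 342, "proved in
[NQD]") DISCHARGED, as the case `U₀ = ⊤` of (T4) (`….of_top`).
[cite: Greenberg2006, pp. 343–344 (Hypothesis L p. 342)] [cite: NguyenQuangDo1984, Thm. 2.2] -/
theorem weakLeopoldt_H2_subsingleton_above_cyclotomic_holds :
    weakLeopoldt_H2_subsingleton_above_cyclotomic :=
  weakLeopoldt_H2_subsingleton_above_cyclotomic_of_isOpen.of_top
    weakLeopoldt_H2_subsingleton_above_cyclotomic_of_isOpen_holds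

end Reduction

end Literature.NumberTheory.IwasawaTheory.Greenberg2006

end
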